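import Mathlib
import HarnessLib
import Summits.Langlands.Langlands.Theses.SteinbergArtinDedekind

/-!
# Birth skeleton (BC3) for crux stmt-Langlands-11805
`Summit.Langlands.Langlands.Theses.SteinbergArtinDedekind.ResidualRegularLift` — line `birth`

Route `route-Langlands-SteinbergArtinDedekind`. The crux (FREE RESIDUAL AUTOMORPHY IN REGULAR WEIGHT at
`p = ℓ`) says: for a prime `ℓ ≥ 5`, a continuous surjective odd `ρ̄ : Γ_ℚ → GL₂(𝔽_ℓ)` and a continuous
`σ : Γ_ℚ → GL_ℓ(ℂ)` carrying the STEINBERG CHARACTER of `ρ̄` (`tr σ(g) = #(ρ̄(g)-stable lines) − 1`), there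
is a WEIGHT-ZERO cuspidal `Π` on `GL_ℓ(𝔸_ℚ)` and a maximal ideal `𝔩 ∋ ℓ` of `ℤ̄ = integralClosure ℤ ℂ`
such that at all but finitely many finite places `v` the (integral) Hecke polynomial of `Π_v` is congruent
modulo `𝔩` to the (integral) characteristic polynomial of `σ(Frob_v)` — the hypothesis of `ArtinWeightLifting`.

On paper it is the composite of three printed theorems, and this skeleton names exactly those three:

* `stub_serreWeightTwo` — **Serre's conjecture in weight two.** `ρ̄` surjective odd, `ℓ ≥ 5` ⟹ a
  weight-zero (= weight-2, trivial coefficients) cuspidal `π₂` on `GL₂(𝔸_ℚ)` and `𝔩 ∋ ℓ` with, for a.e. `v`,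
  an integral Hecke polynomial `(X − r₁)(X − r₂)`, `rᵢ ∈ ℤ̄`, congruent mod `𝔩` to `charpoly ρ̄(Frob_v)`
  (Khare–Wintenberger 2009 Thm 1.2 + Kisin; weight-2 transfer at level `N(ρ̄)ℓ²`: Ash–Stevens 1986 Thm 3.5;
  Eichler–Shimura/Deligne dictionary newform ↦ `π_g`).
* `stub_symPowerLift` — **`Sym^(ℓ−1)` functoriality for weight-two forms with full residual image.** For such a
  `π₂` (congruent mod `𝔩` to a SURJECTIVE `ρ̄`, hence non-CM) there is a weight-zero cuspidal `Π` on `GL_ℓ(𝔸_ℚ)`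
  whose Hecke polynomial at a.e. `v` is `∏_{i<ℓ} (X − r₁^i r₂^(ℓ−1−i))` whenever `(X − r₁)(X − r₂)` is the Hecke
  polynomial of `π₂` at `v` (Newton–Thorne 2021 Thm A; unramified local–global compatibility; uniqueness of
  Satake parameters, Flath; the infinity type of `Sym^(ℓ−1)` of weight `2` is `ρ_{GL_ℓ}`).
* `stub_steinbergFrobenius` — **the defining-characteristic miracle at Frobenius elements.** `σ` is unramified
  at a.e. `v`, `charpoly σ(Frob_v) = Q_v ∈ ℤ[X]` is well defined, and `Q_v ≡ ∏_{i<ℓ} (X − r₁^i r₂^(ℓ−1−i)) mod 𝔩`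
  as soon as `charpoly ρ̄(Frob_v) ≡ (X − r₁)(X − r₂) mod 𝔩` — i.e. `St ⊗ 𝔽_ℓ = L(ℓ−1) = Sym^(ℓ−1)` read on the
  eigenvalues of `ρ̄(Frob_v)` (the route's support item `SteinbergCongruence`, stmt-Langlands-11804, plus
  "Artin representations are unramified almost everywhere" and Frobenius-coset bookkeeping; Humphreys 2005 Ch. 9).
* `ResidualRegularLift_of` — **the composition, kernel-checked:** intersect the three cofinite sets of places
  (`Filter.Eventually` bookkeeping), take `P_v := ∏_{i<ℓ} (X − r₁^i r₂^(ℓ−1−i)) ∈ ℤ̄[X]` and `Q_v ∈ ℤ[X]`.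
  Concludes the route decl BY NAME.

Frobenius conventions: `HasFrobCharpolyAt` is the ARITHMETIC Frobenius (GaloisRep.lean, OUTLINE §1); every stub
compares polynomials at the SAME Frobenius elements / the same place, so the stubs are convention-robust (apply
Serre's conjecture to `ρ̄` or to its contragredient `ρ̄^∨`, which is again surjective and odd).

Disproof used: none on file for this crux (`ledger crux ls stmt-Langlands-11805`: no `Disproof.lean`, no
`Negative/` lemmas, 2026-08-17).

Shape (for `ledger skeleton check` / `#h21_check_skeleton`): stubs `theorem stub_<name> : <signature> := by sorry`
stated over tree declarations only (`Literature.NumberTheory.GaloisRepresentations.FramedGaloisRep{.IsOdd,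
.IsUnramifiedAt,.HasFrobCharpolyAt}`, `Literature.NumberTheory.Automorphic.{isCompact_glFiniteIntegralLevel,
CuspidalAutomorphicRepData, AutomorphicRepData.HasWeightZero, AutomorphicRepData.HasHeckePolynomialAt}`, Mathlib
`integralClosure ℤ ℂ`, `Ideal.Quotient.mk`, `Polynomial.map`); `_Goal.stub_<name> : Prop := type_of% @stub_<name>`
names each statement; the composition `ResidualRegularLift_of (hS : _Goal.stub_serreWeightTwo)
(hP : _Goal.stub_symPowerLift) (hF : _Goal.stub_steinbergFrobenius) : ResidualRegularLift` is proved without `sorry`.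
-/

set_option linter.dupNamespace false
set_option linter.unusedVariables false

noncomputable section

namespace Summit.Langlands.Langlands.Cruxes.ResidualRegularLift.Birth

open Summit.Langlands.Langlands.Theses.SteinbergArtinDedekind
open Literature.NumberTheory.GaloisRepresentations Literature.NumberTheory.Automorphic
open Polynomial
open scoped BigOperators NumberField

/-! ## 1. The three stubs -/

/-- **STUB 1 — Serre's conjecture in weight two (residual modularity of `ρ̄`, cohomological weight).**
For a prime `ℓ ≥ 5` and a continuous surjective odd `ρ̄ : Γ_ℚ → GL₂(𝔽_ℓ)` there are a weight-zero cuspidal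
automorphic representation `π₂` of `GL₂(𝔸_ℚ)` (the unitary `π_g` of a weight-2 cuspidal eigenform `g`) and a
maximal ideal `𝔩` of `ℤ̄ = integralClosure ℤ ℂ` above `ℓ` such that for all but finitely many finite places `v`:
`π₂` has an INTEGRAL Hecke polynomial `(X − r₁)(X − r₂)` at `v` (`r₁ + r₂ = a_p(g)`, `r₁ r₂ = ε(p) p`), every
arithmetic Frobenius at `v` has characteristic polynomial `Q₂ mod ℓ` under `ρ̄` for one `Q₂ ∈ ℤ[X]`, and
`(X − r₁)(X − r₂) ≡ Q₂ (mod 𝔩)`. On paper: Khare–Wintenberger (+ Kisin) give a newform of weight `k(ρ̄)` and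
level `N(ρ̄)`; Ash–Stevens Thm 3.5 moves the mod-`ℓ` eigensystem to weight `2`, level `Γ₁(N(ρ̄)ℓ²)`; `ρ̄`
irreducible so the form is cuspidal; roots of a monic polynomial over `ℤ̄` lie in `ℤ̄`; `𝔩` = any maximal ideal of
`ℤ̄` above the prime `λ ∣ ℓ` of the coefficient field realising the congruence (lying over). Apply it to `ρ̄` or to
`ρ̄^∨` according to the Frobenius convention of `HasHeckePolynomialAt`. Size: L on paper (known), XL in Lean.
[cite: KhareWintenberger2009, Thm 1.2] [cite: AshStevens1986, Thm 3.5] -/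
theorem stub_serreWeightTwo :
    ∀ (ℓ : ℕ) [Fact ℓ.Prime], 5 ≤ ℓ →
      ∀ (ρ : FramedGaloisRep ℚ (ZMod ℓ) 2), Function.Surjective ρ → ρ.IsOdd →
        ∃ (hcpt₂ : isCompact_glFiniteIntegralLevel 2 ℚ) (π₂ : CuspidalAutomorphicRepData 2 ℚ hcpt₂),
          π₂.1.HasWeightZero ∧
          ∃ 𝔩 : Ideal ↥(integralClosure ℤ ℂ), 𝔩.IsMaximal ∧ ((ℓ : ℕ) : ↥(integralClosure ℤ ℂ)) ∈ 𝔩 ∧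
            ∀ᶠ v : IsDedekindDomain.HeightOneSpectrum (NumberField.RingOfIntegers ℚ) in Filter.cofinite,
              ∃ (r₁ r₂ : ↥(integralClosure ℤ ℂ)) (Q₂ : Polynomial ℤ),
                π₂.1.HasHeckePolynomialAt v
                    (((X - C r₁) * (X - C r₂)).map (algebraMap ↥(integralClosure ℤ ℂ) ℂ)) ∧
                ρ.HasFrobCharpolyAt v (Q₂.map (Int.castRingHom (ZMod ℓ))) ∧
                ((X - C r₁) * (X - C r₂)).map (Ideal.Quotient.mk 𝔩) =
                  (Q₂.map (Int.castRingHom ↥(integralClosure ℤ ℂ))).map (Ideal.Quotient.mk 𝔩) := by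
  sorry

/-- **STUB 2 — symmetric power functoriality `Sym^(ℓ−1) : GL₂ → GL_ℓ` for weight-two forms with full
residual image.** Let `ℓ ≥ 5` be prime, `ρ̄ : Γ_ℚ → GL₂(𝔽_ℓ)` continuous and SURJECTIVE, `π₂` a weight-zero
cuspidal automorphic representation of `GL₂(𝔸_ℚ)` and `𝔩 ∋ ℓ` a maximal ideal of `ℤ̄` such that at a.e. `v` an
integral Hecke polynomial `(X − r₁)(X − r₂)` of `π₂` is congruent mod `𝔩` to the characteristic polynomial of
`ρ̄` at the Frobenii of `v` (so `ρ̄_{π₂,𝔩} ≅ ρ̄` up to the Frobenius convention, by Chebotarev + Brauer–Nesbitt;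
in particular `π₂` is not CM, its residual image containing `SL₂(𝔽_ℓ)`). THEN there is a weight-zero cuspidal
automorphic representation `Π` of `GL_ℓ(𝔸_ℚ)` (namely `Sym^(ℓ−1) π₂`: infinity type
`{i − (ℓ−1)/2}_{0 ≤ i < ℓ} = ρ_{GL_ℓ}`, i.e. cohomological with trivial coefficients) such that for a.e. `v`,
whenever `(X − r₁)(X − r₂)` (`rᵢ ∈ ℤ̄`) is a Hecke polynomial of `π₂` at `v`, `∏_{i<ℓ} (X − r₁^i r₂^(ℓ−1−i))`
is a Hecke polynomial of `Π` at `v` (Satake parameter of `Sym^(ℓ−1)`: `{α₁^i α₂^(ℓ−1−i)}`, and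
`q^((ℓ−1)/2) α₁^i α₂^(ℓ−1−i) = (q^(1/2)α₁)^i (q^(1/2)α₂)^(ℓ−1−i)`; uniqueness of Satake parameters, Flath 1979
Thm 3, turns "a Hecke polynomial" into "the"). Newton–Thorne, *Symmetric power functoriality for holomorphic
modular forms* I–II (2021), Thm A (all `Sym^n`, all non-CM regular algebraic cuspidal `π` on `GL₂/ℚ`), with
local–global compatibility at unramified places. On the tree: the named fact
`Literature.NumberTheory.Automorphic.NewtonThorne2021_exists_cuspidal_symmPowerLift` (weak `Sym^m` lift on the
`L²` objects `CuspidalAutomorphicRepGL`; bridge to `CuspidalAutomorphicRepData` via `hasSatakeParamAt_iff_L2` /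
`AutomorphicRepsGL.exists_cuspidalRepData_of_L2`). Size: L on paper (known), XL in Lean.
[cite: NewtonThorneIHES2021b, Thm A] [cite: NewtonThorneIHES2021a, Thm A] [cite: Flath1979, Thm. 3] -/
theorem stub_symPowerLift :
    ∀ (ℓ : ℕ) [Fact ℓ.Prime], 5 ≤ ℓ →
      ∀ (ρ : FramedGaloisRep ℚ (ZMod ℓ) 2), Function.Surjective ρ →
        ∀ (hcpt₂ : isCompact_glFiniteIntegralLevel 2 ℚ) (π₂ : CuspidalAutomorphicRepData 2 ℚ hcpt₂),
          π₂.1.HasWeightZero →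
          ∀ 𝔩 : Ideal ↥(integralClosure ℤ ℂ), 𝔩.IsMaximal → ((ℓ : ℕ) : ↥(integralClosure ℤ ℂ)) ∈ 𝔩 →
            (∀ᶠ v : IsDedekindDomain.HeightOneSpectrum (NumberField.RingOfIntegers ℚ) in Filter.cofinite,
              ∃ (r₁ r₂ : ↥(integralClosure ℤ ℂ)) (Q₂ : Polynomial ℤ),
                π₂.1.HasHeckePolynomialAt v
                    (((X - C r₁) * (X - C r₂)).map (algebraMap ↥(integralClosure ℤ ℂ) ℂ)) ∧
                ρ.HasFrobCharpolyAt v (Q₂.map (Int.castRingHom (ZMod ℓ))) ∧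
                ((X - C r₁) * (X - C r₂)).map (Ideal.Quotient.mk 𝔩) =
                  (Q₂.map (Int.castRingHom ↥(integralClosure ℤ ℂ))).map (Ideal.Quotient.mk 𝔩)) →
            ∃ (hcpt : isCompact_glFiniteIntegralLevel ℓ ℚ) (piL : CuspidalAutomorphicRepData ℓ ℚ hcpt),
              piL.1.HasWeightZero ∧
              ∀ᶠ v : IsDedekindDomain.HeightOneSpectrum (NumberField.RingOfIntegers ℚ) in Filter.cofinite,
                ∀ (r₁ r₂ : ↥(integralClosure ℤ ℂ)),
                  π₂.1.HasHeckePolynomialAt v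
                      (((X - C r₁) * (X - C r₂)).map (algebraMap ↥(integralClosure ℤ ℂ) ℂ)) →
                  piL.1.HasHeckePolynomialAt v
                    ((∏ i ∈ Finset.range ℓ, (X - C (r₁ ^ i * r₂ ^ (ℓ - 1 - i)))).map
                      (algebraMap ↥(integralClosure ℤ ℂ) ℂ)) := by
  sorry

/-- **STUB 3 — the Steinberg congruence at Frobenius elements (`St ⊗ 𝔽_ℓ = L(ℓ−1) = Sym^(ℓ−1)`), with the
ramification bookkeeping of an Artin representation.** Let `ℓ` be prime, `ρ̄ : Γ_ℚ → GL₂(𝔽_ℓ)` and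
`σ : Γ_ℚ → GL_ℓ(ℂ)` continuous with `tr σ(g) = #(ρ̄(g)-stable lines in 𝔽_ℓ²) − 1` for all `g`, and `𝔩 ∋ ℓ` a
maximal ideal of `ℤ̄`. Then for all but finitely many finite places `v`: (i) `σ` is unramified at `v` (`σ` has
finite image by no-small-subgroups, `ker σ = ρ̄⁻¹(centre)` is open, so `σ` factors through a finite Galois
extension, unramified outside its discriminant); (ii) there is ONE `Q ∈ ℤ[X]` which is the characteristic
polynomial of `σ` at every arithmetic Frobenius of every prime above `v` (class function on the Frobenius coset
of the trivialised inertia; the Steinberg character has integer values, so `Q ∈ ℤ[X]` by Newton's identities);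
(iii) if every Frobenius at `v` has `charpoly ρ̄ = Q₂ mod ℓ` and `(X − r₁)(X − r₂) ≡ Q₂ (mod 𝔩)` with
`rᵢ ∈ ℤ̄`, then `Q ≡ ∏_{i<ℓ} (X − r₁^i r₂^(ℓ−1−i)) (mod 𝔩)`: in the field `ℤ̄/𝔩 ⊇ 𝔽_ℓ` the eigenvalues of
`ρ̄(Frob_v)` are `{r̄₁, r̄₂}` (unique factorisation in `(ℤ̄/𝔩)[X]`), and the Brauer character of the Steinberg
lattice in DEFINING characteristic is that of `Sym^(ℓ−1)(𝔽_ℓ²)` — the route's support item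
`SteinbergCongruence` (stmt-Langlands-11804, finite group theory on the four class types of `GL₂(𝔽_ℓ)`,
brute-forced for `ℓ ≤ 11` by the refuters) evaluated at a Frobenius (Frobenii exist at every `v`:
`primesAbove` non-empty, Frobenius elements exist in `Γ_ℚ`). Size: M.
[cite: Humphreys2005, Ch. 9] [cite: SerreLinearRepresentations1977, §18] [cite: SerreAbelianLadic1968, Ch. I §2.1] -/
theorem stub_steinbergFrobenius :
    ∀ (ℓ : ℕ) [Fact ℓ.Prime] (ρ : FramedGaloisRep ℚ (ZMod ℓ) 2) (σ : FramedGaloisRep ℚ ℂ ℓ),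
      (∀ g, ((σ g : Matrix (Fin ℓ) (Fin ℓ) ℂ)).trace =
        ((Nat.card {w : Fin 2 → ZMod ℓ // w ≠ 0 ∧ ∃ a : ZMod ℓ,
            ((ρ g : Matrix (Fin 2) (Fin 2) (ZMod ℓ))).mulVec w = a • w} : ℂ)) / ((ℓ : ℂ) - 1) - 1) →
        ∀ 𝔩 : Ideal ↥(integralClosure ℤ ℂ), 𝔩.IsMaximal → ((ℓ : ℕ) : ↥(integralClosure ℤ ℂ)) ∈ 𝔩 →
          ∀ᶠ v : IsDedekindDomain.HeightOneSpectrum (NumberField.RingOfIntegers ℚ) in Filter.cofinite,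
            σ.IsUnramifiedAt v ∧
            ∃ Q : Polynomial ℤ, σ.HasFrobCharpolyAt v (Q.map (Int.castRingHom ℂ)) ∧
              ∀ (Q₂ : Polynomial ℤ) (r₁ r₂ : ↥(integralClosure ℤ ℂ)),
                ρ.HasFrobCharpolyAt v (Q₂.map (Int.castRingHom (ZMod ℓ))) →
                ((X - C r₁) * (X - C r₂)).map (Ideal.Quotient.mk 𝔩) =
                  (Q₂.map (Int.castRingHom ↥(integralClosure ℤ ℂ))).map (Ideal.Quotient.mk 𝔩) →
                (Q.map (Int.castRingHom ↥(integralClosure ℤ ℂ))).map (Ideal.Quotient.mk 𝔩) =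
                  (∏ i ∈ Finset.range ℓ, (X - C (r₁ ^ i * r₂ ^ (ℓ - 1 - i)))).map (Ideal.Quotient.mk 𝔩) := by
  sorry

/-! ## 2. The stub statements as named `Prop`s (literally their types) -/

namespace _Goal

/-- The statement of `stub_serreWeightTwo`, as a named `Prop` (literally its type). [folklore] -/
def stub_serreWeightTwo : Prop :=
  type_of% @Summit.Langlands.Langlands.Cruxes.ResidualRegularLift.Birth.stub_serreWeightTwo

/-- The statement of `stub_symPowerLift`, as a named `Prop` (literally its type). [folklore] -/
def stub_symPowerLift : Prop :=
  type_of% @Summit.Langlands.Langlands.Cruxes.ResidualRegularLift.Birth.stub_symPowerLift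

/-- The statement of `stub_steinbergFrobenius`, as a named `Prop` (literally its type). [folklore] -/
def stub_steinbergFrobenius : Prop :=
  type_of% @Summit.Langlands.Langlands.Cruxes.ResidualRegularLift.Birth.stub_steinbergFrobenius

end _Goal

/-! ## 3. The composition (kernel-checked, no `sorry`): SERRE → SYM^(ℓ−1) → STEINBERG → the crux by name -/

/-- **`ResidualRegularLift` from the three stubs.** Fix `ℓ ≥ 5`, `ρ̄` surjective odd and `σ` with the
Steinberg character of `ρ̄`. `stub_serreWeightTwo` gives `(π₂, 𝔩)` with `π₂` weight-zero cuspidal on `GL₂/ℚ`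
congruent to `ρ̄` mod `𝔩` at a.e. `v`; `stub_symPowerLift` turns it into a weight-zero cuspidal `Π` on `GL_ℓ/ℚ`
with Hecke polynomials `∏ (X − r₁^i r₂^(ℓ−1−i))` at a.e. `v`; `stub_steinbergFrobenius` says `σ` is unramified
with integral Frobenius polynomial `Q_v ≡ ∏ (X − r₁^i r₂^(ℓ−1−i)) mod 𝔩` at a.e. `v`. Intersecting the three
cofinite sets of places gives the conclusion with `P_v := ∏ (X − r₁^i r₂^(ℓ−1−i)) ∈ ℤ̄[X]` and `Q_v ∈ ℤ[X]`.
The hypotheses are, by name, the statements of the three stubs; the conclusion is the route decl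
`Summit.Langlands.Langlands.Theses.SteinbergArtinDedekind.ResidualRegularLift`. [folklore] -/
theorem ResidualRegularLift_of (hS : _Goal.stub_serreWeightTwo) (hP : _Goal.stub_symPowerLift)
    (hF : _Goal.stub_steinbergFrobenius) :
    Summit.Langlands.Langlands.Theses.SteinbergArtinDedekind.ResidualRegularLift := by
  -- the stub statements, as the Π-types they literally are
  have hSerre : type_of% @stub_serreWeightTwo := hS
  have hSym : type_of% @stub_symPowerLift := hP
  have hSt : type_of% @stub_steinbergFrobenius := hF
  intro ℓ _ hℓ ρ σ hsurj hodd hchar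
  -- Serre: a weight-two `π₂` congruent to `ρ̄` modulo `𝔩 ∣ ℓ`
  obtain ⟨hcpt₂, π₂, hw₂, 𝔩, h𝔩, hℓ𝔩, hev₂⟩ := hSerre ℓ hℓ ρ hsurj hodd
  -- Newton–Thorne: `Π = Sym^(ℓ−1) π₂`, weight zero, Hecke roots `r₁^i r₂^(ℓ−1−i)`
  obtain ⟨hcpt, piL, hwL, hevL⟩ := hSym ℓ hℓ ρ hsurj hcpt₂ π₂ hw₂ 𝔩 h𝔩 hℓ𝔩 hev₂
  -- Steinberg congruence at Frobenius + a.e. unramifiedness of `σ`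
  have hevσ := hSt ℓ ρ σ hchar 𝔩 h𝔩 hℓ𝔩
  refine ⟨hcpt, piL, hwL, 𝔩, h𝔩, hℓ𝔩, ?_⟩
  filter_upwards [hev₂, hevL, hevσ] with v h₂ hLv hσv
  obtain ⟨r₁, r₂, Q₂, hhecke, hfrob, hcong⟩ := h₂
  obtain ⟨hunr, Q, hσfrob, hσcong⟩ := hσv
  exact ⟨∏ i ∈ Finset.range ℓ, (X - C (r₁ ^ i * r₂ ^ (ℓ - 1 - i))), Q, hLv r₁ r₂ hhecke, hunr, hσfrob,
    (hσcong Q₂ r₁ r₂ hfrob hcong).symm⟩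

/-- By-name sanity check (an `example`, not a declaration of the file): the three stubs feed the
composition as they stand. -/
example : Summit.Langlands.Langlands.Theses.SteinbergArtinDedekind.ResidualRegularLift :=
  ResidualRegularLift_of stub_serreWeightTwo stub_symPowerLift stub_steinbergFrobenius

end Summit.Langlands.Langlands.Cruxes.ResidualRegularLift.Birth

end
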